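import Literature.Analysis.FluidPDE.ClassicalNSFourierModes
import Literature.Analysis.FunctionSpaces.TimeIncrementsL3Cauchy
import Literature.Analysis.FunctionSpaces.DiagonalWeakLimits
import Literature.Analysis.FunctionSpaces.TorusMollifiedFieldFourierBounds
import HarnessLib

/-!
# Classical Navier–Stokes families on `T^d × (0,T)` bounded in `L³`: a subsequence whose
# Fourier modes are Cauchy in `L³(0,T)`

Analysis/FluidPDE support file (theorem-only). The time-direction half of the Aubin–Lions–Simon
compactness step in De Rosa–Isett's proof of the vanishing-viscosity intermittency theorem
(ARMA 248 (2024), §6.1: "by the Aubin-Lions-Simon Lemma we can extract a further subsequence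
such that `v^ν → v` in `L^p_{x,t}`"; Simon 1987, §8, Thm. 5 / Cor. 4), carried out on the Fourier
side as in Robinson–Rodrigo–Sadowski 2016, Thm. 4.4, Step 3: for a sequence `(u_j, p_j)` of
classical solutions of the unforced Navier–Stokes equations on the open strip `(0,T) × T^d` with
bounded viscosities `|ν_j| ≤ ν_max` and a uniform bound `∫₀ᵀ∫ |u_j|³ ≤ B`,

* `integrableOn_integral_norm_pow` — `t ↦ ∫ ‖u_j(t)‖^r` (`r ≤ 3`) is integrable on `(0,T)` with
  `∫₀ᵀ∫ ‖u_j‖^r ≤ B + T` (`a^r ≤ a³ + 1`);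
* `integrableOn_mFourierCoeff_slice` — the coefficient functions `t ↦ û_j(t,k)` are integrable on
  `(0,T)` with `∫₀ᵀ |û_j(t,k)| ≤ ∫₀ᵀ∫ ‖u_j‖`;
* `exists_subseq_forall_modes_cauchy_L3` — **there is one subsequence `φ` along which, for every
  frequency `k`, `t ↦ û_{φ(n)}(t,k)` is a Cauchy sequence in `L³(0,T)`**: the increments of the
  coefficients are controlled by the integrable rates
  `C_k ∫‖u_j‖² + |ν_j| 4π²|k|² ∫‖u_j‖` (`IsClassicalNSSolutionOn.norm_mFourierCoeff_sub_le`,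
  `ClassicalNSFourierModes`) whose integrals are bounded uniformly in `j`; the cell averages
  `∫_{I_l} û_j(·,k)` over the cells of all uniform partitions of `(0,T)` are bounded by `B + T`,
  so Cantor's diagonal procedure (`exists_strictMono_forall_tendsto`, `DiagonalWeakLimits`) makes
  all of them converge along one subsequence, and the quantitative time-compactness lemma
  `exists_forall_lintegral_enorm_sub_pow_three_le_of_increments` (`TimeIncrementsL3Cauchy`)
  concludes, one frequency at a time.

The space direction (Besov bound, mollification, finitely many modes) is
`Torus.exists_forall_lintegral_sub_pow_three_le_of_modes` (`TorusSpaceTimeL3Cauchy`); the two are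
combined in `Literature.Barriers.AnomalousDissipation.IntermittentDissipationCompactness`.

## Mathlib search

Mathlib (this pin): `integral_eq_lintegral_of_nonneg_ae`, `ofReal_integral_eq_lintegral_ofReal`,
`Integrable.mono'`, `setIntegral_mono_set`; no Navier–Stokes notions and no Aubin–Lions–Simon
theorem (tree: `ClassicalNSFourierModes`, `TimeIncrementsL3Cauchy`, `DiagonalWeakLimits`).

## References

* L. De Rosa, P. Isett, Arch. Ration. Mech. Anal. 248 (2024), Paper No. 11 = arXiv:2212.08176,
  §6.1 (proof of Thm. 2.13). [DeRosaIsett2024]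
* J. Simon, Ann. Mat. Pura Appl. (4) 146 (1987), §8, Thm. 5 and Cor. 4. [Simon1986]
* J. C. Robinson, J. L. Rodrigo, W. Sadowski, *The Three-Dimensional Navier–Stokes Equations*
  (CUP 2016), Thm. 4.4, Step 3, (4.12)–(4.13). [RobinsonRodrigoSadowski2016]
-/

noncomputable section

open MeasureTheory Set Filter UnitAddTorus Function Metric
open scoped ENNReal NNReal Topology

namespace Literature.Analysis.FluidPDE

open Literature.Analysis.FunctionSpaces Literature.Analysis.FunctionSpaces.Torus

variable {d : Type*} [Fintype d] [DecidableEq d]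

/-! ## Uniform integral bounds from an `L³` bound -/

section Bounds

/-- `a^r ≤ a³ + 1` in `ℝ≥0∞` for `r ≤ 3`. [folklore] -/
theorem pow_le_pow_three_add_one (a : ℝ≥0∞) {r : ℕ} (hr : r ≤ 3) : a ^ r ≤ a ^ 3 + 1 := by
  rcases le_total a 1 with ha | ha
  · exact (pow_le_one₀ (by simp) ha).trans le_add_self
  · exact (pow_le_pow_right₀ ha hr).trans le_self_add

omit [DecidableEq d] in
/-- **Integrability of `t ↦ ∫ ‖u(t)‖^r`, `r ≤ 3`, from a space–time `L³` bound.** For a field `u`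
jointly smooth on `(0,T) × T^d` with `∫₀ᵀ∫ ‖u‖³ ≤ B < ∞`, the function `t ↦ ∫ ‖u(t,x)‖^r dx` is
integrable on `(0,T)` and `∫₀ᵀ ∫ ‖u‖^r ≤ B + T` (pointwise `a^r ≤ a³ + 1`, the torus has volume
one). [folklore] -/
theorem integrableOn_integral_norm_pow {T : ℝ} (hT : 0 ≤ T)
    {u : ℝ → UnitAddTorus d → EuclideanSpace ℝ d} (hu : IsSmoothSpaceTimeOn (Ioo 0 T) u)
    {B : ℝ≥0∞} (hB : B ≠ ⊤) (hL3 : ∫⁻ t in Ioo 0 T, ∫⁻ x, ‖u t x‖ₑ ^ 3 ≤ B) {r : ℕ} (hr : r ≤ 3) :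
    IntegrableOn (fun t => ∫ x, ‖u t x‖ ^ r) (Ioo 0 T) ∧
      ∫ t in Ioo 0 T, ∫ x, ‖u t x‖ ^ r ≤ B.toReal + T := by
  set E : ℝ → ℝ := fun t => ∫ x, ‖u t x‖ ^ r with hE
  have hE0 : ∀ t, 0 ≤ E t := fun t => integral_nonneg fun x => by positivity
  have hEc : ContinuousOn E (Ioo 0 T) :=
    continuousOn_integral_of_continuousOn_stLift
      ((continuous_norm.pow r).comp_continuousOn hu.continuousOn_stLift)
  have hEm : AEStronglyMeasurable E (volume.restrict (Ioo 0 T)) :=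
    hEc.aestronglyMeasurable measurableSet_Ioo
  have hslice : ∀ t ∈ Ioo 0 T, ENNReal.ofReal (E t) ≤ (∫⁻ x, ‖u t x‖ₑ ^ 3) + 1 := by
    intro t ht
    have hc : Continuous (u t) := (hu.isSmooth_slice ht).continuous
    have hi : Integrable (fun x => ‖u t x‖ ^ r) volume := (hc.norm.pow r).integrable_unitAddTorus
    rw [hE, ofReal_integral_eq_lintegral_ofReal hi (ae_of_all _ fun x => by positivity)]
    calc ∫⁻ x, ENNReal.ofReal (‖u t x‖ ^ r) = ∫⁻ x, ‖u t x‖ₑ ^ r := by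
          refine lintegral_congr fun x => ?_
          rw [ENNReal.ofReal_pow (norm_nonneg _), ofReal_norm]
      _ ≤ ∫⁻ x, (‖u t x‖ₑ ^ 3 + 1) := lintegral_mono fun x => pow_le_pow_three_add_one _ hr
      _ = (∫⁻ x, ‖u t x‖ₑ ^ 3) + 1 := by
          rw [lintegral_add_right _ measurable_const, lintegral_const, measure_univ, mul_one]
  have hvol : ∫⁻ _t in Ioo 0 T, (1 : ℝ≥0∞) = ENNReal.ofReal T := by
    rw [setLIntegral_const, Real.volume_Ioo, sub_zero, one_mul]
  have hlin : ∫⁻ t in Ioo 0 T, ENNReal.ofReal (E t) ≤ B + ENNReal.ofReal T := by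
    calc ∫⁻ t in Ioo 0 T, ENNReal.ofReal (E t)
        ≤ ∫⁻ t in Ioo 0 T, ((∫⁻ x, ‖u t x‖ₑ ^ 3) + 1) := setLIntegral_mono' measurableSet_Ioo hslice
      _ = (∫⁻ t in Ioo 0 T, ∫⁻ x, ‖u t x‖ₑ ^ 3) + ∫⁻ _t in Ioo 0 T, (1 : ℝ≥0∞) :=
          lintegral_add_right _ measurable_const
      _ ≤ B + ENNReal.ofReal T := by rw [hvol]; gcongr
  have hfin : HasFiniteIntegral E (volume.restrict (Ioo 0 T)) := by
    have htop : B + ENNReal.ofReal T < ⊤ := ENNReal.add_lt_top.2 ⟨hB.lt_top, ENNReal.ofReal_lt_top⟩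
    refine lt_of_le_of_lt ?_ htop
    calc ∫⁻ t in Ioo 0 T, ‖E t‖ₑ = ∫⁻ t in Ioo 0 T, ENNReal.ofReal (E t) :=
          lintegral_congr fun t => Real.enorm_of_nonneg (hE0 t)
      _ ≤ B + ENNReal.ofReal T := hlin
  refine ⟨⟨hEm, hfin⟩, ?_⟩
  rw [integral_eq_lintegral_of_nonneg_ae (ae_of_all _ hE0) hEm]
  calc (∫⁻ t in Ioo 0 T, ENNReal.ofReal (E t)).toReal ≤ (B + ENNReal.ofReal T).toReal :=
        ENNReal.toReal_mono (ENNReal.add_ne_top.2 ⟨hB, ENNReal.ofReal_ne_top⟩) hlin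
    _ = B.toReal + T := by rw [ENNReal.toReal_add hB ENNReal.ofReal_ne_top, ENNReal.toReal_ofReal hT]

omit [DecidableEq d] in
/-- **Integrability of the Fourier coefficient functions** `t ↦ û(t,k)` on `(0,T)` for a jointly
smooth field with `t ↦ ∫ ‖u(t)‖` integrable, and `∫₀ᵀ |û(t,k)| dt ≤ ∫₀ᵀ ∫ ‖u‖`
(`|û(t,k)| ≤ ‖u(t)‖_{L¹}`). [folklore] -/
theorem integrableOn_mFourierCoeff_slice {T : ℝ} {u : ℝ → UnitAddTorus d → EuclideanSpace ℝ d}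
    (hu : IsSmoothSpaceTimeOn (Ioo 0 T) u) (hE1 : IntegrableOn (fun t => ∫ x, ‖u t x‖) (Ioo 0 T))
    (k : d → ℤ) :
    IntegrableOn (fun t => mFourierCoeff (EuclideanSpace.complexify ∘ u t) k) (Ioo 0 T) ∧
      ∫ t in Ioo 0 T, ‖mFourierCoeff (EuclideanSpace.complexify ∘ u t) k‖ ≤
        ∫ t in Ioo 0 T, ∫ x, ‖u t x‖ := by
  have hm : AEStronglyMeasurable (fun t => mFourierCoeff (EuclideanSpace.complexify ∘ u t) k)
      (volume.restrict (Ioo 0 T)) :=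
    (continuousOn_mFourierCoeff_of_continuousOn_stLift hu.continuousOn_stLift k).aestronglyMeasurable
      measurableSet_Ioo
  have hbound : ∀ᵐ t ∂(volume.restrict (Ioo 0 T)),
      ‖mFourierCoeff (EuclideanSpace.complexify ∘ u t) k‖ ≤ ∫ x, ‖u t x‖ :=
    (ae_restrict_iff' measurableSet_Ioo).2 (ae_of_all _ fun t ht =>
      norm_mFourierCoeff_complexify_le_integral_norm (hu.isSmooth_slice ht).integrable k)
  have hint : IntegrableOn (fun t => mFourierCoeff (EuclideanSpace.complexify ∘ u t) k) (Ioo 0 T) :=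
    Integrable.mono' hE1 hm hbound
  exact ⟨hint, integral_mono_ae hint.norm hE1 hbound⟩

end Bounds

/-! ## The subsequence with Cauchy Fourier modes -/

section Modes

/-- **A subsequence along which every Fourier mode is Cauchy in `L³(0,T)`** (the time-direction
half of the Aubin–Lions–Simon step of De Rosa–Isett 2024, §6.1, on the Fourier side;
Robinson–Rodrigo–Sadowski 2016, Thm. 4.4, Step 3; Simon 1987, §8, Thm. 5). Let `(u_j, p_j)` be
classical solutions of the unforced Navier–Stokes equations on `(0,T) × T^d` with viscosities
`|ν_j| ≤ ν_max` and `∫₀ᵀ∫ ‖u_j‖³ ≤ B < ∞` for all `j`. Then there is a strictly increasing `φ`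
such that for every frequency `k` and every `η > 0` there is `N` with
`∫₀ᵀ ‖û_{φ n}(t,k) - û_{φ m}(t,k)‖³ dt ≤ η` for all `n, m ≥ N`. Proof: the increments of
`t ↦ û_j(t,k)` are bounded by `∫ₛᵗ (C_k ∫‖u_j‖² + |ν_j| 4π²|k|² ∫‖u_j‖)`
(`IsClassicalNSSolutionOn.norm_mFourierCoeff_sub_le`), rates with integral `≤ (C_k + ν_max 4π²|k|²)(B + T)`;
the cell averages of the coefficient functions over all cells of all uniform partitions of `(0,T)`
are bounded by `B + T`, so one diagonal subsequence makes all of them converge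
(`exists_strictMono_forall_tendsto`), and `exists_forall_lintegral_enorm_sub_pow_three_le_of_increments`
gives the Cauchy property frequency by frequency. [cite: DeRosaIsett2024, §6.1 (proof of Thm. 2.13)] [cite: Simon1986, §8 Thm. 5] -/
theorem exists_subseq_forall_modes_cauchy_L3 {T : ℝ} (hT : 0 < T) {ν : ℕ → ℝ} {νmax : ℝ}
    (hν : ∀ j, |ν j| ≤ νmax)
    {u : ℕ → ℝ → UnitAddTorus d → EuclideanSpace ℝ d} {p : ℕ → ℝ → UnitAddTorus d → ℝ}
    (hNS : ∀ j, IsClassicalNSSolutionOn (Ioo 0 T) (ν j) 0 (u j) (p j))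
    {B : ℝ≥0∞} (hB : B ≠ ⊤) (hL3 : ∀ j, ∫⁻ t in Ioo 0 T, ∫⁻ x, ‖u j t x‖ₑ ^ 3 ≤ B) :
    ∃ φ : ℕ → ℕ, StrictMono φ ∧ ∀ (k : d → ℤ) (η : ℝ≥0∞), 0 < η → ∃ N : ℕ, ∀ n m : ℕ,
      N ≤ n → N ≤ m →
        ∫⁻ t in Ioo 0 T, ‖mFourierCoeff (EuclideanSpace.complexify ∘ u (φ n) t) k -
          mFourierCoeff (EuclideanSpace.complexify ∘ u (φ m) t) k‖ₑ ^ 3 ≤ η := by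
  -- notation
  set F : ℕ → (d → ℤ) → ℝ → EuclideanSpace ℂ d :=
    fun j k t => mFourierCoeff (EuclideanSpace.complexify ∘ u j t) k with hF
  set E2 : ℕ → ℝ → ℝ := fun j t => ∫ x, ‖u j t x‖ ^ 2 with hE2
  set E1 : ℕ → ℝ → ℝ := fun j t => ∫ x, ‖u j t x‖ with hE1
  set Ck : (d → ℤ) → ℝ := fun k => Fintype.card d * (2 * Real.pi * Real.sqrt (freqNormSq k)) with hCk
  set ck : (d → ℤ) → ℝ := fun k => 4 * Real.pi ^ 2 * freqNormSq k with hck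
  set g : ℕ → (d → ℤ) → ℝ → ℝ := fun j k τ => Ck k * (∫ x, ‖u j τ x‖ ^ 2) +
    |ν j| * ck k * (∫ x, ‖u j τ x‖) +
      ∫ x, ‖(0 : ℝ → UnitAddTorus d → EuclideanSpace ℝ d) τ x‖ with hg
  set R : ℝ := B.toReal + T with hR
  have hνmax : 0 ≤ νmax := (abs_nonneg _).trans (hν 0)
  have hCk0 : ∀ k, 0 ≤ Ck k := fun k => by
    have := freqNormSq_nonneg k
    simp only [hCk]
    positivity
  have hck0 : ∀ k, 0 ≤ ck k := fun k => by
    have := freqNormSq_nonneg k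
    simp only [hck]
    positivity
  -- uniform bounds
  have hsm : ∀ j, IsSmoothSpaceTimeOn (Ioo 0 T) (u j) := fun j => (hNS j).smooth_velocity
  have hE2i : ∀ j, IntegrableOn (E2 j) (Ioo 0 T) ∧ ∫ t in Ioo 0 T, E2 j t ≤ R := fun j =>
    integrableOn_integral_norm_pow hT.le (hsm j) hB (hL3 j) (by norm_num : 2 ≤ 3)
  have hE1i : ∀ j, IntegrableOn (E1 j) (Ioo 0 T) ∧ ∫ t in Ioo 0 T, E1 j t ≤ R := fun j => by
    have h := integrableOn_integral_norm_pow hT.le (hsm j) hB (hL3 j) (by norm_num : 1 ≤ 3)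
    simpa only [pow_one] using h
  have hFi : ∀ j k, IntegrableOn (F j k) (Ioo 0 T) ∧ ∫ t in Ioo 0 T, ‖F j k t‖ ≤ R := fun j k => by
    obtain ⟨h1, h2⟩ := integrableOn_mFourierCoeff_slice (hsm j) (hE1i j).1 k
    exact ⟨h1, h2.trans (hE1i j).2⟩
  have hE10 : ∀ j t, 0 ≤ E1 j t := fun j t => integral_nonneg fun x => norm_nonneg _
  have hE20 : ∀ j t, 0 ≤ E2 j t := fun j t => integral_nonneg fun x => by positivity
  -- the rates
  have hgeq : ∀ j k τ, g j k τ = Ck k * E2 j τ + |ν j| * ck k * E1 j τ := by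
    intro j k τ
    simp [hg, hE2, hE1]
  have hg0 : ∀ j k, ∀ τ ∈ Ioo 0 T, 0 ≤ g j k τ := fun j k τ _ => by
    rw [hgeq]
    have := hE10 j τ
    have := hE20 j τ
    have := hCk0 k
    have := hck0 k
    positivity
  have hgi' : ∀ j k, IntegrableOn (fun τ => Ck k * E2 j τ + |ν j| * ck k * E1 j τ) (Ioo 0 T) :=
    fun j k => ((hE2i j).1.const_mul (Ck k)).add ((hE1i j).1.const_mul (|ν j| * ck k))
  have hgi : ∀ j k, IntegrableOn (g j k) (Ioo 0 T) := fun j k =>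
    (hgi' j k).congr_fun (fun τ _ => (hgeq j k τ).symm) measurableSet_Ioo
  have hG : ∀ j k, ∫ τ in Ioo 0 T, g j k τ ≤ (Ck k + νmax * ck k) * R := by
    intro j k
    rw [setIntegral_congr_fun measurableSet_Ioo (fun τ _ => hgeq j k τ),
      integral_add ((hE2i j).1.const_mul (Ck k)) ((hE1i j).1.const_mul (|ν j| * ck k)),
      integral_const_mul, integral_const_mul]
    have h1 : Ck k * ∫ τ in Ioo 0 T, E2 j τ ≤ Ck k * R :=
      mul_le_mul_of_nonneg_left (hE2i j).2 (hCk0 k)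
    have h2 : |ν j| * ck k * ∫ τ in Ioo 0 T, E1 j τ ≤ νmax * ck k * R := by
      have hI0 : 0 ≤ ∫ τ in Ioo 0 T, E1 j τ := setIntegral_nonneg measurableSet_Ioo fun τ _ => hE10 j τ
      exact mul_le_mul (mul_le_mul_of_nonneg_right (hν j) (hck0 k)) (hE1i j).2 hI0
        (mul_nonneg hνmax (hck0 k))
    linarith
  have hinc : ∀ j k, ∀ ⦃s t : ℝ⦄, s ∈ Ioo 0 T → t ∈ Ioo 0 T → s ≤ t →
      ‖F j k t - F j k s‖ ≤ ∫ τ in s..t, g j k τ := fun j k s t hs ht hst =>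
    (hNS j).norm_mFourierCoeff_sub_le (convex_Ioo 0 T) hs ht hst k
  -- cell averages and the diagonal extraction
  set x : ℕ → (d → ℤ) × ℕ × ℕ → EuclideanSpace ℂ d := fun j i =>
    if i.2.2 ≤ i.2.1 then
      ∫ t in Ioo ((i.2.2 : ℝ) * (T / (i.2.1 + 1))) ((i.2.2 + 1 : ℝ) * (T / (i.2.1 + 1))), F j i.1 t
    else 0 with hx
  have hcell : ∀ L l : ℕ, l ≤ L →
      Ioo ((l : ℝ) * (T / (L + 1))) ((l + 1 : ℝ) * (T / (L + 1))) ⊆ Ioo 0 T := by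
    intro L l hl
    have hh : 0 < T / (L + 1) := by positivity
    have hnh : ((L + 1 : ℕ) : ℝ) * (T / (L + 1)) = T := by push_cast; field_simp
    exact Ioo_cell_subset hh hnh (Nat.lt_succ_iff.2 hl)
  have hxb : ∀ j i, ‖x j i‖ ≤ R := by
    intro j i
    obtain ⟨k, L, l⟩ := i
    simp only [hx]
    split_ifs with hl
    · calc ‖∫ t in Ioo ((l : ℝ) * (T / (L + 1))) ((l + 1 : ℝ) * (T / (L + 1))), F j k t‖
          ≤ ∫ t in Ioo ((l : ℝ) * (T / (L + 1))) ((l + 1 : ℝ) * (T / (L + 1))), ‖F j k t‖ :=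
            norm_integral_le_integral_norm _
        _ ≤ ∫ t in Ioo 0 T, ‖F j k t‖ :=
            setIntegral_mono_set (hFi j k).1.norm (ae_of_all _ fun t => norm_nonneg _)
              (hcell L l hl).eventuallyLE
        _ ≤ R := (hFi j k).2
    · rw [norm_zero]
      positivity
  obtain ⟨φ, hφ, hconv⟩ := exists_strictMono_forall_tendsto x fun i =>
    ⟨0, R, fun j => mem_closedBall_zero_iff.2 (hxb j i)⟩
  refine ⟨φ, hφ, fun k η hη => ?_⟩
  have havg : ∀ L l : ℕ, l ≤ L → ∃ c : EuclideanSpace ℂ d, Tendsto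
      (fun n => ∫ t in Ioo ((l : ℝ) * (T / (L + 1))) ((l + 1 : ℝ) * (T / (L + 1))), F (φ n) k t)
        atTop (𝓝 c) := by
    intro L l hl
    obtain ⟨c, hc⟩ := hconv (k, L, l)
    refine ⟨c, ?_⟩
    have hfun : (fun n => x (φ n) (k, L, l)) = fun n =>
        ∫ t in Ioo ((l : ℝ) * (T / (L + 1))) ((l + 1 : ℝ) * (T / (L + 1))), F (φ n) k t := by
      funext n
      simp only [hx, if_pos hl]
    rw [← hfun]
    exact hc
  exact exists_forall_lintegral_enorm_sub_pow_three_le_of_increments hT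
    (fun n => (hFi (φ n) k).1) (fun n => hgi (φ n) k) (fun n => hg0 (φ n) k)
    (fun n => hinc (φ n) k) (fun n => hG (φ n) k) havg hη

end Modes

end Literature.Analysis.FluidPDE

end
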